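import Summits.NavierStokesRegularity.NavierStokesRegularity.Theorems.MustSqueeze.Negative.TwoPassGronwallLoadBearing

/-!
# Crux `MustSqueeze` (stmt-NavierStokesRegularity-11610), negative side: the two-pass engine at zero damping

Negative-side (cdisprove gen 4, D-0016) support lemma extracted from `Cruxes/MustSqueeze/Disproof.lean`
v11 §10 (Targets), companion of `Negative.TwoPassGronwallLoadBearing`: the lead's abstract real-analysis stub
`stub_twoPassGronwall` (skeleton v1 of line outward-drift-signed-flux, sha 75fd2eb7) with its strict damping
`0 < c` weakened to `0 ≤ c` — i.e. the engine run AT the quarter `a = 1/4`, `c = 2(¼ − a) = 0` — is FALSE: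
the frozen state `Z ≡ E ≡ 1`, `K ≡ 0`, `c = κ = κ' = 0`, `B = 1` satisfies every clause and `E ≠ 0`
(`twoPassGronwall_false_at_zero_damping`).  The abstract shadow of `Negative.QuarterLerayExponent.quarter_rate_saturates`:
at the quarter the similarity enstrophy may sit at a nonzero constant forever (Leray's exact rate
`‖ω‖² ∼ (T−t)^{−1/2}`), so `a < 1/4` is sharp inside the lead's own stub.  Nothing here closes the item.
-/

noncomputable section

namespace Summit.NavierStokesRegularity.NavierStokesRegularity.Theorems.MustSqueeze.Negative

open MeasureTheory

/-- `stub_twoPassGronwall` with the strict damping `0 < c` weakened to `0 ≤ c` — i.e. the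
abstract two-pass engine run AT the quarter, `c = 2(¼ − a) = 0`. -/
def TwoPassGronwallNonnegDamping : Prop :=
  ∀ (c κ κ' B : ℝ) (Z E : ℝ → ℝ → ℝ), 0 ≤ c →
    (∀ (ρ s : ℝ), 0 < ρ → 0 ≤ E ρ s) →
    (∀ ρ : ℝ, 0 < ρ → Continuous (E ρ)) →
    (∀ (s ρ ρ' : ℝ), 0 < ρ → ρ ≤ ρ' → E ρ s ≤ E ρ' s) →
    (∀ (s ρ : ℝ), 1 ≤ ρ → ∫ σ in s..(s + 1), E ρ σ ≤ B * ρ) →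
    (∀ R : ℝ, 1 ≤ R → Differentiable ℝ (Z R) ∧ ∃ K : ℝ → ℝ, Continuous K ∧ (∀ s, 0 ≤ K s) ∧
      (∀ s, K s ≤ κ * (E (2 * R) s / R + Real.sqrt (E (2 * R) s / R))) ∧
      ∀ s, deriv (Z R) s ≤ -c * Z R s + K s) →
    (∀ (R s : ℝ), 1 ≤ R → 0 ≤ Z R s) →
    (∀ (R R' s : ℝ), 1 ≤ R → R ≤ R' → Z R s ≤ Z R' s) →
    (∀ (R s : ℝ), 1 ≤ R → Z R s ≤ 6 * E (2 * R) s) →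
    (∀ (R s : ℝ), 1 ≤ R → E R s ≤ Z R s + κ' * Real.sqrt (E (2 * R) s / R)) →
    ∀ (ρ s : ℝ), 0 < ρ → E ρ s = 0

/-- **Zero damping is fatal** (tightness of `0 < c`, i.e. of `a < 1/4`, inside the lead's own
stub): with `0 ≤ c` the abstract stub is FALSE — the frozen state `Z ≡ E ≡ 1`, `K ≡ 0`,
`c = κ = κ' = 0`, `B = 1` satisfies every clause (all comparisons with room) and `E ≠ 0`.  This is
the abstract shadow of `quarter_rate_saturates`: at the quarter the similarity enstrophy may sit
at a nonzero constant forever, which is Leray's exact rate `‖ω‖² ∼ (T−t)^{−1/2}`. -/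
theorem twoPassGronwall_false_at_zero_damping : ¬ TwoPassGronwallNonnegDamping := by
  intro h
  have key := h 0 0 0 1 (fun _ _ => 1) (fun _ _ => 1) le_rfl
    (fun _ _ _ => zero_le_one)
    (fun _ _ => continuous_const)
    (fun _ _ _ _ _ => le_rfl)
    (fun s ρ hρ => by simp; linarith)
    (fun R _ => ⟨differentiable_const _, fun _ => 0, continuous_const, fun _ => le_rfl,
      fun s => by simp, fun s => by simp⟩)
    (fun _ _ _ => zero_le_one)
    (fun _ _ _ _ _ => le_rfl)
    (fun R s _ => by norm_num)
    (fun R s _ => by simp)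
    1 0 one_pos
  norm_num at key

end Summit.NavierStokesRegularity.NavierStokesRegularity.Theorems.MustSqueeze.Negative

end
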